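import Mathlib.Algebra.Polynomial.Taylor
import Summits.ResolutionOfSingularities.ResolutionOfSingularities.Theorems.WeightedInvariantLocalWeightedDropNCDirectrixCutWeierstrass

/-!
# Local weighted drop — NC directrix cut: the TSCHIRNHAUS WITNESS of a tame unary vertex in good position

W4.3 / crux item `stmt-ResolutionOfSingularities-8899` (`WeightedInvariant.LocalWeightedDrop`), registered line `directrix-cut`
(v3f, stub `stub_freeTameThree` = `FreeTame p k 3`).  OURS (kernel entrance lemma for the tame free unary piece; candidates, not facts,
until reviewed).  Sequel to `…NCDirectrixCutWeierstrass` (the Weierstrass witness `Decoration.exists_weierstrassWitness_of_goodDir`).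

For a decoration `δ` in GOOD position (`δ.GoodDir`: no old components and a directrix form involving a non-letter) whose order
`o = δ.o` is INVERTIBLE in `k` (the tame case `¬ p ∣ o`), we produce a legal count move `Φ` — zero constant terms, invertible linear part,
every boundary letter `l ∈ δ.E` sent to `v · X l'` with `l' ≠ 0` and `v` a unit — such that

  `Φ^* f = u · (x₀ ^ o + Σ_{i<o} a_i x₀ ^ i)`, `u` a unit, every `a_i` free of `x₀`, and `a_{o-1} = 0`.

So `V(x₀)` is a hypersurface of maximal contact in Tschirnhaus position and the letters restrict to coordinate hyperplanes of
`V(x₀) ≅ Spf k⟦x₁, …, x_m⟧` (an SNC boundary there for free): the entrance to the marked-ideal / companion-ideal induction on `V(x₀)`.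

## Contents
1. series free of `x₀` = the range of `rename Fin.succ` (`exists_eq_rename_succ_of_xfree`, `xfree_rename_succ`), and a substitution fixing
   `x₁, …, x_m` fixes them (`subst_eq_self_of_xfree`);
2. constant coefficients: `constantCoeff_subst_of_constantCoeff_zero` (any number of variables) and the vanishing of the constant terms of
   the Weierstrass coefficients `constantCoeff_weierstrassCoeff_eq_zero`;
3. the Tschirnhaus translation of a monic polynomial over a subalgebra, via `Polynomial.taylor` / `hasseDeriv` (`exists_tschirnhaus_coeffs`);
4. the witness `Decoration.exists_tschirnhausWitness_of_goodDir` (Weierstrass witness, first-order chain rule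
   `CobordantArc.coeff_degree_one_subst`, unitriangular linear part of the translation `x₀ ↦ x₀ - a_{o-1}/o`).

References: the Tschirnhaus / maximal-contact coordinate is classical (Abhyankar; Encinas–Villamayor, Kollár *Lectures on resolution* §3.5,
Włodarczyk 2005); here it is only the formal-power-series bookkeeping over `MvPowerSeries (Fin (m+1)) k`.
-/

set_option linter.dupNamespace false

noncomputable section

namespace Summit.ResolutionOfSingularities.ResolutionOfSingularities.Theorems

namespace TameFourTupleDrop

open MvPowerSeries Literature.AlgebraicGeometry.Resolution

variable {k : Type} [Field k] {m : ℕ}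

/-! ## 1. Series free of `x₀` -/

/-- The embedding of the non-zero slots. -/
private theorem succ_emb_apply (j : Fin m) : (⟨Fin.succ, Fin.succ_injective m⟩ : Fin m ↪ Fin (m + 1)) j = j.succ := rfl

/-- A series free of `x₀` (no monomial with a positive `x₀`-exponent) is the renaming of a series in the other variables. -/
theorem exists_eq_rename_succ_of_xfree {g : MvPowerSeries (Fin (m + 1)) k} (hg : ∀ n : Fin (m + 1) →₀ ℕ, n 0 ≠ 0 → coeff n g = 0) :
    ∃ g' : MvPowerSeries (Fin m) k, g = rename (Fin.succ : Fin m → Fin (m + 1)) g' := by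
  classical
  let e : Fin m ↪ Fin (m + 1) := ⟨Fin.succ, Fin.succ_injective m⟩
  refine ⟨killCompl e g, ?_⟩
  ext n
  by_cases hn : n 0 = 0
  · -- `n` is supported away from `0`, hence in the image of `embDomain e`
    have hsupp : ↑n.support ⊆ Set.range e := by
      intro i hi
      have hi' : n i ≠ 0 := Finsupp.mem_support_iff.mp hi
      rcases Fin.eq_zero_or_eq_succ i with h | ⟨j, rfl⟩
      · exact absurd (h ▸ hi') (by rw [hn]; exact fun h => h rfl)
      · exact ⟨j, rfl⟩
    have hne : n = Finsupp.embDomain e (Finsupp.comapDomain e n e.injective.injOn) :=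
      (Finsupp.embDomain_comapDomain hsupp).symm
    rw [hne, show (rename (Fin.succ : Fin m → Fin (m + 1)) (killCompl e g) : MvPowerSeries (Fin (m + 1)) k) =
      rename e (killCompl e g) from rfl, coeff_embDomain_rename, coeff_killCompl]
  · rw [hg n hn, show (rename (Fin.succ : Fin m → Fin (m + 1)) (killCompl e g) : MvPowerSeries (Fin (m + 1)) k) =
      rename e (killCompl e g) from rfl, coeff_rename_eq_zero]
    rintro ⟨x, hx⟩
    apply hn
    rw [← hx]
    exact Finsupp.mapDomain_notin_range _ _ fun ⟨j, hj⟩ => Fin.succ_ne_zero j hj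

/-- Conversely a renamed series is free of `x₀`. -/
theorem xfree_rename_succ (g' : MvPowerSeries (Fin m) k) :
    ∀ n : Fin (m + 1) →₀ ℕ, n 0 ≠ 0 → coeff n (rename (Fin.succ : Fin m → Fin (m + 1)) g') = 0 := by
  intro n hn
  apply coeff_rename_eq_zero
  rintro ⟨x, hx⟩
  apply hn
  rw [← hx]
  exact Finsupp.mapDomain_notin_range _ _ fun ⟨j, hj⟩ => Fin.succ_ne_zero j hj

/-- A substitution fixing the non-zero slots fixes every series free of `x₀`. -/
theorem subst_eq_self_of_xfree {θ : Fin (m + 1) → MvPowerSeries (Fin (m + 1)) k} (hθ : HasSubst θ)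
    (hθX : ∀ j : Fin m, θ j.succ = X j.succ) {g : MvPowerSeries (Fin (m + 1)) k}
    (hg : ∀ n : Fin (m + 1) →₀ ℕ, n 0 ≠ 0 → coeff n g = 0) : subst θ g = g := by
  obtain ⟨g', rfl⟩ := exists_eq_rename_succ_of_xfree hg
  rw [rename_eq_subst, subst_comp_subst_apply (HasSubst.X_comp (Fin.succ : Fin m → Fin (m + 1))) hθ]
  congr 1
  funext j
  rw [Function.comp_apply, subst_X hθ, hθX]

/-- A substitution by series without constant terms keeps the constant term. -/
theorem constantCoeff_subst_of_constantCoeff_zero {θ : Fin (m + 1) → MvPowerSeries (Fin (m + 1)) k}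
    (hθ0 : ∀ i, constantCoeff (θ i) = 0) (g : MvPowerSeries (Fin (m + 1)) k) : constantCoeff (subst θ g) = constantCoeff g := by
  have hθ := hasSubst_of_constantCoeff_zero hθ0
  have hsplit : g = C (constantCoeff g) + (g - C (constantCoeff g)) := by ring
  conv_lhs => rw [hsplit]
  rw [subst_add hθ, subst_C, map_add, constantCoeff_C, constantCoeff_subst_eq_zero hθ hθ0 (by simp), add_zero]

/-! ## 2. The Weierstrass coefficients have no constant terms -/

/-- If `F = u · (x₀^o + Σ_{i<o} a_i x₀^i)` with `u` a unit, the `a_i` free of `x₀`, and `F` has no pure power `x₀^j`, `j < o`, then the `a_i`,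
`i < o`, have zero constant term.  (Kill the other variables: `x₀^o + Σ a_i(0) x₀^i = ū⁻¹ · F̄` has `x₀`-order `≥ o`.) -/
theorem constantCoeff_weierstrassCoeff_eq_zero {F u : MvPowerSeries (Fin (m + 1)) k} {a : ℕ → MvPowerSeries (Fin (m + 1)) k} {o : ℕ}
    (hu : constantCoeff u ≠ 0) (ha : ∀ i (n : Fin (m + 1) →₀ ℕ), n 0 ≠ 0 → coeff n (a i) = 0)
    (hW : F = u * (X 0 ^ o + ∑ i ∈ Finset.range o, a i * X 0 ^ i))
    (hlow : ∀ j < o, coeff (Finsupp.single 0 j) F = 0) : ∀ i < o, constantCoeff (a i) = 0 := by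
  classical
  -- kill the variables `x_1, …, x_m`
  let e : Unit ↪ Fin (m + 1) := ⟨fun _ => 0, fun _ _ _ => rfl⟩
  let κ : MvPowerSeries (Fin (m + 1)) k →ₐ[k] PowerSeries k := killCompl e
  have hκ : ∀ (g : MvPowerSeries (Fin (m + 1)) k) (j : ℕ), PowerSeries.coeff j (κ g) = coeff (Finsupp.single 0 j) g := by
    intro g j
    rw [PowerSeries.coeff, coeff_killCompl, Finsupp.embDomain_single]
    rfl
  -- the killed polynomial part
  have hκP : ∀ j < o, PowerSeries.coeff j (κ (X 0 ^ o + ∑ i ∈ Finset.range o, a i * X 0 ^ i)) = constantCoeff (a j) := by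
    intro j hj
    rw [hκ, map_add, coeff_X_pow, if_neg (fun h => absurd (Finsupp.single_injective 0 h) (Nat.ne_of_lt hj)), zero_add, map_sum]
    rw [Finset.sum_eq_single j]
    · rw [X_pow_eq, coeff_mul_monomial, if_pos le_rfl, tsub_self, mul_one, coeff_zero_eq_constantCoeff]
    · intro i _ hij
      rw [X_pow_eq, coeff_mul_monomial]
      split_ifs with hle
      · have hij' : i < j := lt_of_le_of_ne (by simpa [Finsupp.single_le_iff] using hle) hij
        rw [← Finsupp.single_tsub, ha i _ (by rw [Finsupp.single_eq_same]; omega), zero_mul]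
      · rfl
    · intro hj'; exact absurd (Finset.mem_range.mpr hj) hj'
  -- orders
  have hunit : PowerSeries.constantCoeff (κ u) ≠ 0 := by
    rw [← PowerSeries.coeff_zero_eq_constantCoeff_apply, hκ]
    simpa [coeff_zero_eq_constantCoeff] using hu
  have hordF : (o : ℕ∞) ≤ (κ F).order := by
    refine PowerSeries.nat_le_order _ _ fun j hj => ?_
    rw [hκ]; exact hlow j hj
  have hordP : (o : ℕ∞) ≤ (κ (X 0 ^ o + ∑ i ∈ Finset.range o, a i * X 0 ^ i)).order := by
    have hmul : κ F = κ u * κ (X 0 ^ o + ∑ i ∈ Finset.range o, a i * X 0 ^ i) := by rw [hW, map_mul]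
    have hu0 : (κ u).order = 0 := PowerSeries.order_zero_of_unit ?_
    · rw [hmul, PowerSeries.order_mul, hu0, zero_add] at hordF
      exact hordF
    · exact PowerSeries.isUnit_iff_constantCoeff.mpr (Ne.isUnit hunit)
  intro i hi
  rw [← hκP i hi]
  exact PowerSeries.coeff_of_lt_order i (lt_of_lt_of_le (by exact_mod_cast hi) hordP)

/-! ## 3. The Tschirnhaus translation of a monic polynomial with coefficients in a subalgebra -/

/-- **TSCHIRNHAUS.**  Over a subalgebra `S` (the series free of `x₀`), if `o · t = a_{o-1}` then
`(y - t)^o + Σ_{i<o} a_i (y - t)^i = y^o + Σ_{i<o} a'_i y^i` with the `a'_i ∈ S` and `a'_{o-1} = 0`. -/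
theorem exists_tschirnhaus_coeffs (S : Subalgebra k (MvPowerSeries (Fin (m + 1)) k)) {o : ℕ} (ho : 0 < o)
    {a : ℕ → MvPowerSeries (Fin (m + 1)) k} (ha : ∀ i, a i ∈ S) {t : MvPowerSeries (Fin (m + 1)) k} (ht : t ∈ S)
    (hot : (o : MvPowerSeries (Fin (m + 1)) k) * t = a (o - 1)) (y : MvPowerSeries (Fin (m + 1)) k) :
    ∃ a' : ℕ → MvPowerSeries (Fin (m + 1)) k, (∀ i, a' i ∈ S) ∧ a' (o - 1) = 0 ∧
      (y - t) ^ o + ∑ i ∈ Finset.range o, a i * (y - t) ^ i = y ^ o + ∑ i ∈ Finset.range o, a' i * y ^ i := by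
  classical
  obtain ⟨o', rfl⟩ : ∃ o', o = o' + 1 := ⟨o - 1, (Nat.sub_add_cancel ho).symm⟩
  simp only [Nat.add_sub_cancel] at hot ⊢
  -- the data inside `S`
  let aS : ℕ → S := fun i => ⟨a i, ha i⟩
  let tS : S := ⟨t, ht⟩
  have hotS : ((o' + 1 : ℕ) : S) * tS = aS o' := Subtype.ext (by simpa [aS, tS] using hot)
  -- the monic polynomial and its translate
  let P : Polynomial S := Polynomial.X ^ (o' + 1) + ∑ i ∈ Finset.range (o' + 1), Polynomial.C (aS i) * Polynomial.X ^ i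
  have hdeg : (∑ i ∈ Finset.range (o' + 1), Polynomial.C (aS i) * Polynomial.X ^ i).degree < ((o' + 1 : ℕ) : WithBot ℕ) := by
    refine lt_of_le_of_lt (Polynomial.degree_sum_le _ _) ((Finset.sup_lt_iff (WithBot.bot_lt_coe _)).mpr fun i hi => ?_)
    exact lt_of_le_of_lt (Polynomial.degree_C_mul_X_pow_le i _) (by exact_mod_cast Finset.mem_range.mp hi)
  have hP : P.Monic := (Polynomial.monic_X_pow _).add_of_left (by rwa [Polynomial.degree_X_pow])
  have hPdeg : P.natDegree = o' + 1 := by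
    rw [Polynomial.natDegree_add_eq_left_of_degree_lt (by rwa [Polynomial.degree_X_pow]), Polynomial.natDegree_X_pow]
  let Q : Polynomial S := P.comp (Polynomial.X - Polynomial.C tS)
  have hQ : Q.Monic := hP.comp (Polynomial.monic_X_sub_C tS) (by rw [Polynomial.natDegree_X_sub_C]; exact one_ne_zero)
  have hQdeg : Q.natDegree = o' + 1 := by
    have h := Polynomial.natDegree_comp (p := P) (q := Polynomial.X - Polynomial.C tS)
    rw [hPdeg, Polynomial.natDegree_X_sub_C, mul_one] at h
    exact h
  have halg : ∀ s : S, algebraMap S (MvPowerSeries (Fin (m + 1)) k) s = (s : MvPowerSeries (Fin (m + 1)) k) := fun s => rfl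
  -- evaluation of `P` and of `Q`
  have hPeval : ∀ z : MvPowerSeries (Fin (m + 1)) k, Polynomial.aeval z P = z ^ (o' + 1) + ∑ i ∈ Finset.range (o' + 1), a i * z ^ i := by
    intro z
    show Polynomial.aeval z (Polynomial.X ^ (o' + 1) + ∑ i ∈ Finset.range (o' + 1), Polynomial.C (aS i) * Polynomial.X ^ i) = _
    simp [map_add, map_sum, map_mul, map_pow, Polynomial.aeval_X, Polynomial.aeval_C, halg, aS]
  have hQeval : Polynomial.aeval y Q = y ^ (o' + 1) + ∑ i ∈ Finset.range (o' + 1), (Q.coeff i : MvPowerSeries (Fin (m + 1)) k) * y ^ i := by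
    conv_lhs => rw [hQ.as_sum, hQdeg]
    simp [map_add, map_sum, map_mul, map_pow, Polynomial.aeval_X, Polynomial.aeval_C, halg]
  have hcomp : Polynomial.aeval y Q = Polynomial.aeval (y - t) P := by
    show Polynomial.aeval y (P.comp (Polynomial.X - Polynomial.C tS)) = _
    rw [Polynomial.aeval_comp]
    congr 1
    simp [Polynomial.aeval_X, Polynomial.aeval_C, halg, tS]
  -- Taylor: the coefficient of `y^{o-1}` of `Q`
  have h2 : ∀ i, Polynomial.hasseDeriv o' (Polynomial.C (aS i) * Polynomial.X ^ i) =
      Polynomial.monomial (i - o') (((i.choose o' : ℕ) : S) * aS i) := fun i => by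
    rw [Polynomial.C_mul_X_pow_eq_monomial, Polynomial.hasseDeriv_monomial]
  have h3 : ∀ i ∈ Finset.range o', Polynomial.hasseDeriv o' (Polynomial.C (aS i) * Polynomial.X ^ i) = 0 := fun i hi => by
    rw [h2, Nat.choose_eq_zero_of_lt (Finset.mem_range.mp hi), Nat.cast_zero, zero_mul, Polynomial.monomial_zero_right]
  have h4 : Polynomial.hasseDeriv o' (Polynomial.C (aS o') * Polynomial.X ^ o') = Polynomial.C (aS o') := by
    rw [h2, Nat.sub_self, Nat.choose_self, Nat.cast_one, one_mul, Polynomial.monomial_zero_left]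
  have h1 : Polynomial.hasseDeriv o' (Polynomial.X ^ (o' + 1) : Polynomial S) = Polynomial.monomial 1 ((o' + 1 : ℕ) : S) := by
    rw [Polynomial.X_pow_eq_monomial, Polynomial.hasseDeriv_monomial, Nat.add_sub_cancel_left, Nat.choose_succ_self_right, mul_one]
  have hH : Polynomial.hasseDeriv o' P = Polynomial.monomial 1 ((o' + 1 : ℕ) : S) + Polynomial.C (aS o') := by
    show Polynomial.hasseDeriv o' (Polynomial.X ^ (o' + 1) + ∑ i ∈ Finset.range (o' + 1), Polynomial.C (aS i) * Polynomial.X ^ i) = _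
    rw [map_add, map_sum, Finset.sum_range_succ, Finset.sum_eq_zero h3, zero_add, h1, h4]
  have hQT : Q = Polynomial.taylor (-tS) P := by
    show P.comp (Polynomial.X - Polynomial.C tS) = _
    rw [Polynomial.taylor_apply, Polynomial.C_neg]
    congr 1
  have hcoef : Q.coeff o' = 0 := by
    rw [hQT, Polynomial.taylor_coeff, hH, Polynomial.eval_add, Polynomial.eval_monomial, Polynomial.eval_C, pow_one, ← hotS]
    ring
  -- the new coefficients
  refine ⟨fun i => (Q.coeff i : MvPowerSeries (Fin (m + 1)) k), fun i => (Q.coeff i).2, ?_, ?_⟩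
  · show ((Q.coeff o' : S) : MvPowerSeries (Fin (m + 1)) k) = 0
    rw [hcoef]; rfl
  · show _ = y ^ (o' + 1) + ∑ i ∈ Finset.range (o' + 1), (Q.coeff i : MvPowerSeries (Fin (m + 1)) k) * y ^ i
    rw [← hQeval, hcomp, hPeval]

/-! ## 4. The Tschirnhaus witness of a tame unary vertex in good position -/

/-- **THE TSCHIRNHAUS WITNESS IN GOOD POSITION** (every `m`; the order `o` invertible in `k`, i.e. TAME): a legal count move `Φ` with every boundary
letter `Φ l = v · X l'`, `l' ≠ 0`, `v` a unit, and `Φ^* f = u · (x₀^o + Σ_{i<o} a_i x₀^i)` with `u` a unit, the `a_i` free of `x₀` and `a_{o-1} = 0` — NO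
term of `x₀`-degree `o - 1`: `V(x₀)` is the Tschirnhaus hypersurface of maximal contact, and the boundary letters are coordinate hyperplanes `V(x_{l'})`,
`l' ≠ 0`, hence restrict to an SNC family of coordinate hyperplanes ON `V(x₀) ≅ Spf k⟦x₁,…,x_m⟧`.  (Weierstrass witness, then the translation
`x₀ ↦ x₀ - a_{o-1}/o`, which fixes `x₁, …, x_m`.) -/
theorem Decoration.exists_tschirnhausWitness_of_goodDir {δ : Decoration k m} (hf : δ.f ≠ 0) (ho : δ.o ≠ 0) (hg : δ.GoodDir)
    (hchar : (δ.o : k) ≠ 0) :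
    ∃ (Φ : Fin (m + 1) → MvPowerSeries (Fin (m + 1)) k) (u : MvPowerSeries (Fin (m + 1)) k) (a : ℕ → MvPowerSeries (Fin (m + 1)) k),
      (∀ i, constantCoeff (Φ i) = 0) ∧
      IsUnit (Matrix.det (Matrix.of fun i j : Fin (m + 1) => coeff (Finsupp.single j 1) (Φ i))) ∧
      (∀ l ∈ δ.E, ∃ (l' : Fin (m + 1)) (v : MvPowerSeries (Fin (m + 1)) k), l' ≠ 0 ∧ constantCoeff v ≠ 0 ∧ Φ l = v * X l') ∧
      constantCoeff u ≠ 0 ∧ (∀ i (n : Fin (m + 1) →₀ ℕ), n 0 ≠ 0 → coeff n (a i) = 0) ∧ a (δ.o - 1) = 0 ∧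
      subst Φ δ.f = u * (X 0 ^ δ.o + ∑ i ∈ Finset.range δ.o, a i * X 0 ^ i) := by
  classical
  obtain ⟨Φ, u, a, h0, hdet, hE, hu, ha, hW⟩ := Decoration.exists_weierstrassWitness_of_goodDir hf ho hg
  have hΦ : HasSubst Φ := hasSubst_of_constantCoeff_zero h0
  -- the Weierstrass coefficients have no constant term
  have hfo : δ.f.order = (δ.o : ℕ∞) := by
    rw [Decoration.o, ENat.coe_toNat]
    rw [ne_eq, order_eq_top_iff]
    exact hf
  have hlow : ∀ j < δ.o, coeff (Finsupp.single 0 j) (subst Φ δ.f) = 0 := by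
    intro j hj
    apply coeff_of_lt_order
    rw [TOT2E1.order_subst_eq_of_legal _ h0 hdet δ.f, hfo, Finsupp.degree_single]
    exact_mod_cast hj
  have ha0 : ∀ i < δ.o, constantCoeff (a i) = 0 := constantCoeff_weierstrassCoeff_eq_zero hu ha hW hlow
  -- the translation `θ : x₀ ↦ x₀ - t`, `t := a_{o-1} / o`, fixing `x₁, …, x_m`
  let t : MvPowerSeries (Fin (m + 1)) k := C ((δ.o : k)⁻¹) * a (δ.o - 1)
  have ht0 : constantCoeff t = 0 := by
    show constantCoeff (C ((δ.o : k)⁻¹) * a (δ.o - 1)) = 0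
    rw [map_mul, ha0 _ (Nat.sub_lt (Nat.pos_of_ne_zero ho) one_pos), mul_zero]
  have htfree : ∀ n : Fin (m + 1) →₀ ℕ, n 0 ≠ 0 → coeff n t = 0 := by
    intro n hn
    show coeff n (C ((δ.o : k)⁻¹) * a (δ.o - 1)) = 0
    rw [coeff_C_mul, ha _ n hn, mul_zero]
  have hot : (δ.o : MvPowerSeries (Fin (m + 1)) k) * t = a (δ.o - 1) := by
    show (δ.o : MvPowerSeries (Fin (m + 1)) k) * (C ((δ.o : k)⁻¹) * a (δ.o - 1)) = _
    rw [← mul_assoc, ← map_natCast (C : k →+* MvPowerSeries (Fin (m + 1)) k) δ.o, ← map_mul, mul_inv_cancel₀ hchar, map_one, one_mul]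
  let θ : Fin (m + 1) → MvPowerSeries (Fin (m + 1)) k := fun i => if i = 0 then X 0 - t else X i
  have hθ0 : ∀ i, constantCoeff (θ i) = 0 := by
    intro i
    by_cases hi : i = 0
    · simp only [θ, if_pos hi, map_sub, constantCoeff_X, ht0, sub_zero]
    · simp only [θ, if_neg hi, constantCoeff_X]
  have hθ : HasSubst θ := hasSubst_of_constantCoeff_zero hθ0
  have hθX : ∀ j : Fin m, θ j.succ = X j.succ := fun j => if_neg (Fin.succ_ne_zero j)
  have hθne : ∀ i : Fin (m + 1), i ≠ 0 → θ i = X i := fun i hi => if_neg hi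
  have hθzero : θ 0 = X 0 - t := if_pos rfl
  -- the linear part of `θ` is unitriangular, of determinant `1`
  have hθtri : (Matrix.of fun i j : Fin (m + 1) => coeff (Finsupp.single j 1) (θ i)).BlockTriangular id := by
    intro i j hij
    have hij' : j < i := hij
    have hi : i ≠ 0 := by
      rintro rfl
      exact absurd hij' (by simp)
    rw [Matrix.of_apply, hθne i hi, coeff_X, if_neg (show (Finsupp.single j 1 : Fin (m + 1) →₀ ℕ) ≠ Finsupp.single i 1 from
      fun h => (ne_of_lt hij') (Finsupp.single_left_injective one_ne_zero h))]
  have hθdet : Matrix.det (Matrix.of fun i j : Fin (m + 1) => coeff (Finsupp.single j 1) (θ i)) = 1 := by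
    rw [Matrix.det_of_upperTriangular hθtri]
    refine Finset.prod_eq_one fun i _ => ?_
    rw [Matrix.of_apply]
    by_cases hi : i = 0
    · rw [hi, hθzero, map_sub, coeff_X, if_pos rfl, htfree _ (by simp), sub_zero]
    · rw [hθne i hi, coeff_X, if_pos rfl]
  -- first-order chain rule: linear parts multiply
  have hlin : (Matrix.of fun i j : Fin (m + 1) => coeff (Finsupp.single j 1) (subst θ (Φ i))) =
      (Matrix.of fun i j : Fin (m + 1) => coeff (Finsupp.single j 1) (Φ i)) *
        (Matrix.of fun i j : Fin (m + 1) => coeff (Finsupp.single j 1) (θ i)) := by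
    ext i j
    rw [Matrix.of_apply, Matrix.mul_apply,
      Literature.AlgebraicGeometry.Resolution.CobordantArc.coeff_degree_one_subst θ hθ0 (Φ i) (Finsupp.single j 1) (Finsupp.degree_single _ _)]
    rfl
  -- the coefficients and `t` lie in the subalgebra of series free of `x₀`
  let S : Subalgebra k (MvPowerSeries (Fin (m + 1)) k) := (rename (R := k) (Fin.succ : Fin m → Fin (m + 1))).range
  have hmemS : ∀ g : MvPowerSeries (Fin (m + 1)) k, (∀ n : Fin (m + 1) →₀ ℕ, n 0 ≠ 0 → coeff n g = 0) → g ∈ S := by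
    intro g hg
    obtain ⟨g', hg'⟩ := exists_eq_rename_succ_of_xfree hg
    exact (AlgHom.mem_range _).mpr ⟨g', hg'.symm⟩
  have hSfree : ∀ g ∈ S, ∀ n : Fin (m + 1) →₀ ℕ, n 0 ≠ 0 → coeff n g = 0 := by
    intro g hg
    obtain ⟨g', rfl⟩ := (AlgHom.mem_range _).mp hg
    exact xfree_rename_succ g'
  obtain ⟨a', ha'S, ha'o, hT⟩ :=
    exists_tschirnhaus_coeffs S (Nat.pos_of_ne_zero ho) (fun i => hmemS _ (ha i)) (hmemS _ htfree) hot (X 0)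
  -- the pulled-back equation
  have hid : subst θ (subst Φ δ.f) = subst θ u * ((X 0 - t) ^ δ.o + ∑ i ∈ Finset.range δ.o, a i * (X 0 - t) ^ i) := by
    rw [hW, ← coe_substAlgHom hθ, map_mul, map_add, map_pow, map_sum, coe_substAlgHom, subst_X hθ, hθzero]
    congr 2
    refine Finset.sum_congr rfl fun i _ => ?_
    rw [← coe_substAlgHom hθ, map_mul, map_pow, coe_substAlgHom, subst_X hθ, hθzero, subst_eq_self_of_xfree hθ hθX (ha i)]
  -- assemble
  refine ⟨fun i => subst θ (Φ i), subst θ u, a', fun i => ?_, ?_, ?_, ?_, fun i => hSfree _ (ha'S i), ha'o, ?_⟩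
  · rw [constantCoeff_subst_of_constantCoeff_zero hθ0, h0]
  · rw [hlin, Matrix.det_mul, hθdet, mul_one]
    exact hdet
  · intro l hl
    obtain ⟨l', v, hl', hv, hΦl⟩ := hE l hl
    refine ⟨l', subst θ v, hl', by rw [constantCoeff_subst_of_constantCoeff_zero hθ0]; exact hv, ?_⟩
    show subst θ (Φ l) = subst θ v * X l'
    rw [hΦl, ← coe_substAlgHom hθ, map_mul, coe_substAlgHom, subst_X hθ, hθne l' hl']
  · rw [constantCoeff_subst_of_constantCoeff_zero hθ0]
    exact hu
  · rw [← subst_comp_subst_apply hΦ hθ, hid, hT]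

end TameFourTupleDrop

end Summit.ResolutionOfSingularities.ResolutionOfSingularities.Theorems
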